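import Summits.SmoothPoincare4.SmoothPoincare4.Theses.ConvexBisection
import Literature.Topology.FourManifolds.PlanarShadowWalk
import Mathlib.Tactic.Group

/-!
# Disproof of `PlanarAcyclicBisectionRigidity` — standing adversary's work file (gen 1, v3, 2026-08-16)

Crux `Summit.SmoothPoincare4.SmoothPoincare4.Theses.ConvexBisection.PlanarAcyclicBisectionRigidity`
(stmt-SmoothPoincare4-15086, route ConvexBisection, rank 5; "PABR" below): *every Hausdorff
second-countable smooth 4-manifold `M ≃ₕ S⁴` that is a Stein bisection `M = e₁W₁ ∪ e₂W₂` along a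
common contact seam, with BOTH HALVES ℚ-ACYCLIC in positive degrees and `(∂W₁, ξ₁)` PLANAR, is
diffeomorphic to `S⁴`.*  PABR = the sibling crux `PlanarBisectionRigidity` (PBR, stmt-10511;
its Disproof v7.2, `Cruxes/PlanarBisectionRigidity/Disproof.lean`, transfers verbatim with the
acyclicity conjunct `hac` carried along) with ℚ-acyclicity moved from a consequence of planarity
(Etnyre 2004 Thm 4.1, unproved tree fact) to a hypothesis.

## Findings (index; every `theorem` is machine-checked; NO `sorry` in this file)

* §1 KILL CRITERION. `of_smoothPoincare4 : SmoothPoincare4 → PABR` (same conclusion for the same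
  `M`); `not_smoothPoincare4_of_not`; `not_iff_exotic`: `¬ PABR ↔` an exotic smooth `M ≃ₕ S⁴`
  carrying a planar ℚ-acyclic common-contact Stein bisection.  NO UNCONDITIONAL KILL short of an
  exotic 4-sphere; the adversary maps the terrain and attacks the picked line instead (§L).
* §2 POSITION AMONG THE SIBLINGS. PABR is the WEAKEST rigidity statement of the route:
  `of_acyclicBisectionRigidity : ABR → PABR` (drop planarity from the hypothesis list = crux 10507),
  `of_planarBisectionRigidity : PBR → PABR` (drop acyclicity = support 10511); conversely
  `planarBisectionRigidity_of : PlanarImpliesAcyclic → PABR → PBR` with the cite-fact (Etnyre 2004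
  Thm 4.1 + `Q ≡ 0` + Mayer–Vietoris) stated inline.  So a refutation of PABR refutes PBR, ABR and
  the summit at once; nothing is gained for a DISproof by the extra hypothesis.
* §3 LOAD-BEARING ANALYSIS (drop one hypothesis at a time; all on paper exactly as PBR Disproof
  v7.2 §3, recorded here for this decl).
  - `M ≃ₕ S⁴` dropped: FALSE on paper — `D(B_{p,q})` (double of a Stein rational ball, Lekili–
    Maydanskiy arXiv:1202.5625; boundary a lens space, planar by Schönenberger; halves ℚ-acyclic,
    `π₁ = ℤ/p`) carries a planar ℚ-acyclic bisection and is not `S⁴`.  Unlike ABR (sibling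
    `Negative.LoadBearing.not_crux_without_homotopyEquiv`, EMPTY witness) no junk witness exists
    here: planarity forces a binding circle, hence `∂W₁ ≠ ∅`, `W₁ ≠ ∅`, `M ≠ ∅`
    (`nonempty_of_planar`, §3) — the honest witness needs a planar `OpenBook` on a lens space,
    not constructible in the tree today (PBR Disproof gap G2-type).
  - planarity dropped: the statement IS `AcyclicBisectionRigidity` (crux 10507) — open, SPC4-hard.
  - acyclicity dropped: the statement IS `PlanarBisectionRigidity` (10511) — equivalent to PABR
    modulo Etnyre (§2).
  - contact matching / Stein / embedding conjuncts dropped: still SPC4-implied (`shielded`, §1),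
    irrefutable; load-bearing only for a PROOF (Wendl needs the common planar contact seam).
* §L LINE `Sketch` (k4-axis-calculus; `Cruxes/…/Lines/Sketch.lean`, seven stubs).  Stubs 1, 6, 7
  are SPC4-implied (shielded shape), stub 5 (`stub_walkHigh`, `n ≥ 4`) is refutable in principle
  but no move-invariant finer than the 4-manifold itself is available (stabilisation is a move).
  THE LEVER `stub_shadowWalkK4` (pure `FreeGroup (Fin 2)`) was attacked as instructed ("a
  Hurwitz-rigid orbit inside `S⁴` refutes it") and SURVIVES — in fact the attack produced a PROOF:
  - (L1, v3: **THE LEVER IS A THEOREM — `stub_shadowWalkK4_holds` (§L-K), verbatim the registered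
    signature, SORRY-FREE, axioms `propext / Classical.choice / Quot.sound`**) K4-WALK holds for
    ALL `(w, P, Q)`: the DESCENT LEMMA (`descent_holds : Descent`, §L-D: conjugate normal forms
    `c r c⁻¹` over `FreeGroup.toWord`, longest common prefix, the SHORT/LONG junction trichotomy
    `junction`, the gluing step `glue` of the left-to-right reduction — three short junctions keep
    all four relator letters in the reduced word of the product, which is `1`, absurd — and the
    norm bounds `norm_long₁/₃` for the two long cases) and the TERMINAL TABLE (`terminal_holds :
    Terminal`, §L-T: signed-shape invariant `AllSigned`, product and length invariants, eight
    uniform rows `row1 … row8` in `F(g, h)`, two dispatch shapes), fed into the strong induction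
    on total reduced length `lever_of_descent_of_terminal`.  The two-axis structure
    (K4AxesEvidence §1–§2) is not needed.  CANDIDATE PROOF FILE for the lead attached as item
    evidence (`CandidateShadowWalkLever.lean`, self-contained over `PlanarShadowWalk.lean`): the
    disprover may not land positive statements; a prover copies it under `Theorems/`.  Machine evidence: `k4/descent.py` (3000 random orbit states, steepest descent never
    stuck), `k4/best2.py` (all 13 two-axis words of cyclic length ≤ 18, both class orders: honest
    double reached, ≤ 10 moves), `k4/terminal.py` (the table).  POSTED to the lead (evidence
    `stubs/K4Walk.md`).
  - (L2, NEGATIVE LEMMA, proposal p100409 `Theorems/PlanarAcyclicBisectionRigidity/Negative/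
    ShadowBallUnreachable.lean`) the natural strengthening "BALL target alone" (`BallOnlyLever`
    below) is FALSE: for the `s`-twin word of length 18 the four start letters generate an
    infinite-index subgroup of `F₂` (certificate `F₂ → S₃`, `x ↦ (1 2)`, `y ↦ (0 2)`: all letters
    fix `0`, the two transpositions have no common fixed point), so NO reachable state is a ball
    state, while an honest double is reached in 4 moves.  The r-family's ball behaviour
    (K4AxesEvidence §4) does not generalise; any proof of the lever must use the double target.
  - (L3, remark to the lead, `stub-misstated (minor)`) `stub_wendlDictionary` clause (iii)
    (`n = 3 → InShadowNormalForm A B`, one central letter) omits the minimal unimodular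
    factorisations on `D₃` with TWO or THREE central letters, e.g. `A = (T_{δ₀}, T_{δ₂}, T_{c₀₁})`
    (hole matrix rows `(1,0,0),(0,0,1),(1,1,0)`, `det = -1`): `(3; A, A)` is an
    `IsIntegralSphereWord` not in shadow normal form.  By the abelianisation
    `Mod(D₃,∂) = F₂ × ℤ⁴ → ℤ² × ℤ⁴` (types `{01} ↦ (1,0;0)`, `{12} ↦ (0,1;0)`, `{02} ↦ (-1,-1;𝟙)`
    by the lantern relation, `δᵢ ↦ (0,0;eᵢ)`) every positive 3-factorisation of such a monodromy
    has the same type multiset, hence equals `A` up to order, and `X_A = B⁴` (`SeamTrivial`):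
    these inputs hit target (i) with zero moves.  Suggested repair: `n = 3 → InShadowNormalForm A B
    ∨ SeamTrivial 3 A`.  Logically harmless (the dictionary may stabilise once and dodge `n = 3`).
* §W WHY THE CRUX RESISTS (for provers).  As PBR v7.2 §9 with one update: at `k = 4`, modulo the
  dictionary (Wendl) and its lift, EVERY integral planar ℚ-acyclic bisection of a homotopy 4-sphere
  re-bisects by signed Hurwitz moves into an honest double `D(X_{A′})`, `X_{A′}` contractible of
  Mazur type — so `k = 4` is standard modulo `stub_wendlDictionary` + `stub_k4Lift` +
  `stub_absorbingTargets(ii)` (crux 3546's `ψ = id` slice); the first layer where a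
  counterexample to the LINE (not to SPC4) could live is `k = 5` (`Mod(D₄, ∂)` is no longer
  centre × free, the shadow trick is unavailable; the descent lemma still holds in every FREE
  quotient but `PB₄/Z` is not free).

Gaps named for planners: G-LB (honest `¬ WithoutHomotopyEquiv` needs a planar `OpenBook` on a lens
space / on `S¹ × S²`: PBR gaps G1–G2).  (Gap G-D of v2 — formalising `Descent` — is CLOSED in v3.)
With the lever proved, the line at `k = 4` rests on `stub_wendlDictionary` (XL vendoring),
`stub_k4Lift` (its DOUBLE branch suffices now: the ball branch of the lift can be dropped) and
`stub_absorbingTargets` (ii) (crux 3546's `ψ = id` slice).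
-/

noncomputable section

-- the prescribed namespace `Summit.<P>.<Sub>.…` duplicates `SmoothPoincare4` (P = Sub)
set_option linter.dupNamespace false

open scoped Manifold ContDiff Topology ContinuousMap
open Set Function CategoryTheory.Limits
open Literature.Geometry.Symplectic Literature.AlgebraicTopology.SingularHomology

namespace Summit.SmoothPoincare4.SmoothPoincare4.Cruxes.PlanarAcyclicBisectionRigidity.Disproof

open Summit.SmoothPoincare4.SmoothPoincare4.Theses.ConvexBisection

/-- Local notation: the model space `ℝ⁴`. -/
local notation "𝔼4" => EuclideanSpace ℝ (Fin 4)
/-- Local notation: the round 4-sphere. -/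
local notation "𝕊⁴" => (Metric.sphere (0 : EuclideanSpace ℝ (Fin 5)) 1)

/-! ## §1 The hypothesis as a predicate; kill criterion -/

/-- **The ∃-hypothesis of the crux as a predicate on `M`** (verbatim the 22-component body:
bisection ∧ contact matching ∧ ℚ-acyclic halves ∧ planar first half). [folklore] -/
def HasPlanarAcyclicSteinBisection (M : Type) [TopologicalSpace M] [ChartedSpace 𝔼4 M] : Prop :=
  ∃ (W₁ : Type) (_ : TopologicalSpace W₁) (_ : ChartedSpace (EuclideanHalfSpace 4) W₁)
    (_ : IsManifold (𝓡∂ 4) ∞ W₁) (_ : CompactSpace W₁) (W₂ : Type) (_ : TopologicalSpace W₂)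
    (_ : ChartedSpace (EuclideanHalfSpace 4) W₂) (_ : IsManifold (𝓡∂ 4) ∞ W₂) (_ : CompactSpace W₂)
    (J₁ : SteinStructure W₁) (J₂ : SteinStructure W₂) (e₁ : W₁ → M) (e₂ : W₂ → M),
    Manifold.IsSmoothEmbedding (𝓡∂ 4) (𝓡 4) ∞ e₁ ∧ Manifold.IsSmoothEmbedding (𝓡∂ 4) (𝓡 4) ∞ e₂ ∧
    Set.range e₁ ∪ Set.range e₂ = Set.univ ∧
    Set.range e₁ ∩ Set.range e₂ = e₁ '' (𝓡∂ 4).boundary W₁ ∧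
    Set.range e₁ ∩ Set.range e₂ = e₂ '' (𝓡∂ 4).boundary W₂ ∧
    (∀ w₁ w₂, e₁ w₁ = e₂ w₂ →
      Submodule.map (mfderiv (𝓡∂ 4) (𝓡 4) e₁ w₁).toLinearMap (contactPlane J₁.J w₁) =
      Submodule.map (mfderiv (𝓡∂ 4) (𝓡 4) e₂ w₂).toLinearMap (contactPlane J₂.J w₂)) ∧
    (∀ k, 0 < k → IsZero (singularHomology ℚ ℚ W₁ k) ∧ IsZero (singularHomology ℚ ℚ W₂ k)) ∧
    PlanarContactBoundary J₁

/-- The crux, unfolded: `PABR ↔ ∀ M ≃ₕ S⁴, HasPlanarAcyclicSteinBisection M → M ≅ S⁴`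
(definitional). [folklore] -/
theorem crux_iff :
    PlanarAcyclicBisectionRigidity ↔
      ∀ (M : Type) [TopologicalSpace M] [T2Space M] [SecondCountableTopology M]
        [ChartedSpace 𝔼4 M] [IsManifold (𝓡 4) ∞ M], M ≃ₕ 𝕊⁴ → HasPlanarAcyclicSteinBisection M →
        Nonempty (M ≃ₘ⟮𝓡 4, 𝓡 4⟯ 𝕊⁴) :=
  Iff.rfl

/-- **SHIELDING**: every statement "`∀ M ≃ₕ S⁴, P M → M ≅ S⁴`" follows from the summit, whatever
`P` is; so the crux and each of its single-conjunct deletions are SPC4-implied. [folklore] -/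
theorem shielded (P : ∀ (M : Type) [TopologicalSpace M] [ChartedSpace 𝔼4 M], Prop)
    (h : _root_.SmoothPoincare4) :
    ∀ (M : Type) [TopologicalSpace M] [T2Space M] [SecondCountableTopology M]
      [ChartedSpace 𝔼4 M] [IsManifold (𝓡 4) ∞ M], M ≃ₕ 𝕊⁴ → P M → Nonempty (M ≃ₘ⟮𝓡 4, 𝓡 4⟯ 𝕊⁴) :=
  fun M _ _ _ _ _ e _ => h M inferInstance inferInstance e

/-- **The crux is implied by the summit** (its conclusion is SPC4's, for the same `M`). [folklore] -/
theorem of_smoothPoincare4 (h : _root_.SmoothPoincare4) : PlanarAcyclicBisectionRigidity :=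
  shielded _ h

/-- **KILL CRITERION**: a refutation of the crux refutes the smooth 4-dimensional Poincaré
conjecture. [folklore] -/
theorem not_smoothPoincare4_of_not (h : ¬ PlanarAcyclicBisectionRigidity) : ¬ _root_.SmoothPoincare4 :=
  fun hs => h (of_smoothPoincare4 hs)

/-- **What a kill IS**: `¬ PABR` holds iff some smooth `M ≃ₕ S⁴` carries a planar ℚ-acyclic Stein
bisection along a common contact seam and admits NO diffeomorphism to `S⁴` — an exotic 4-sphere
with extra structure. [folklore] -/
theorem not_iff_exotic :
    ¬ PlanarAcyclicBisectionRigidity ↔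
      ∃ (M : Type) (_ : TopologicalSpace M) (_ : T2Space M) (_ : SecondCountableTopology M)
        (_ : ChartedSpace 𝔼4 M) (_ : IsManifold (𝓡 4) ∞ M),
        Nonempty (M ≃ₕ 𝕊⁴) ∧ HasPlanarAcyclicSteinBisection M ∧ IsEmpty (M ≃ₘ⟮𝓡 4, 𝓡 4⟯ 𝕊⁴) := by
  rw [crux_iff]
  constructor
  · intro h
    simp only [not_forall] at h
    obtain ⟨M, _, _, _, _, _, e, hP, hM⟩ := h
    exact ⟨M, ‹_›, ‹_›, ‹_›, ‹_›, ‹_›, ⟨e⟩, hP, not_nonempty_iff.1 hM⟩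
  · rintro ⟨M, _, _, _, _, _, ⟨e⟩, hP, hM⟩ h
    exact not_nonempty_iff.2 hM (h M e hP)

/-! ## §2 Position among the sibling statements -/

/-- **PABR follows from crux 2 `AcyclicBisectionRigidity`** (drop the planarity conjunct).
[folklore] -/
theorem of_acyclicBisectionRigidity (h : AcyclicBisectionRigidity) : PlanarAcyclicBisectionRigidity := by
  intro M _ _ _ _ _ e hb
  obtain ⟨W₁, _, _, _, _, W₂, _, _, _, _, J₁, J₂, e₁, e₂, h₁, h₂, hcov, hs₁, hs₂, hξ, hac, -⟩ := hb
  exact h M e ⟨W₁, _, _, _, _, W₂, _, _, _, _, J₁, J₂, e₁, e₂, h₁, h₂, hcov, hs₁, hs₂, hξ, hac⟩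

/-- **PABR follows from the vestigial support `PlanarBisectionRigidity`** (drop the acyclicity
conjunct). [folklore] -/
theorem of_planarBisectionRigidity (h : PlanarBisectionRigidity) : PlanarAcyclicBisectionRigidity := by
  intro M _ _ _ _ _ e hb
  obtain ⟨W₁, _, _, _, _, W₂, _, _, _, _, J₁, J₂, e₁, e₂, h₁, h₂, hcov, hs₁, hs₂, hξ, -, hpl⟩ := hb
  exact h M e ⟨W₁, _, _, _, _, W₂, _, _, _, _, J₁, J₂, e₁, e₂, h₁, h₂, hcov, hs₁, hs₂, hξ, hpl⟩

/-- **THE CITE-FACT separating PABR from PBR** ("planar ⇒ ℚ-acyclic halves" inside a homotopy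
4-sphere: Etnyre arXiv:math/0404267 Thm 4.1 gives `b₂⁺ = b₂⁰ = 0` and connected boundary for
every filling of a planar contact manifold; `Q(Wᵢ) ≡ 0` for codimension-0 pieces of a homology
sphere and Mayer–Vietoris then give ℚ-acyclicity), stated as a `Prop` over the crux's own binders
so that nothing is asserted. (Etnyre 2004 Thm 4.1.) [folklore] -/
def PlanarImpliesAcyclic : Prop :=
  ∀ (M : Type) [TopologicalSpace M] [T2Space M] [SecondCountableTopology M]
    [ChartedSpace 𝔼4 M] [IsManifold (𝓡 4) ∞ M], M ≃ₕ 𝕊⁴ →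
    ∀ (W₁ : Type) [TopologicalSpace W₁] [ChartedSpace (EuclideanHalfSpace 4) W₁]
      [IsManifold (𝓡∂ 4) ∞ W₁] [CompactSpace W₁] (W₂ : Type) [TopologicalSpace W₂]
      [ChartedSpace (EuclideanHalfSpace 4) W₂] [IsManifold (𝓡∂ 4) ∞ W₂] [CompactSpace W₂]
      (J₁ : SteinStructure W₁) (J₂ : SteinStructure W₂) (e₁ : W₁ → M) (e₂ : W₂ → M),
      Manifold.IsSmoothEmbedding (𝓡∂ 4) (𝓡 4) ∞ e₁ → Manifold.IsSmoothEmbedding (𝓡∂ 4) (𝓡 4) ∞ e₂ →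
      Set.range e₁ ∪ Set.range e₂ = Set.univ →
      Set.range e₁ ∩ Set.range e₂ = e₁ '' (𝓡∂ 4).boundary W₁ →
      Set.range e₁ ∩ Set.range e₂ = e₂ '' (𝓡∂ 4).boundary W₂ →
      (∀ w₁ w₂, e₁ w₁ = e₂ w₂ →
        Submodule.map (mfderiv (𝓡∂ 4) (𝓡 4) e₁ w₁).toLinearMap (contactPlane J₁.J w₁) =
        Submodule.map (mfderiv (𝓡∂ 4) (𝓡 4) e₂ w₂).toLinearMap (contactPlane J₂.J w₂)) →
      PlanarContactBoundary J₁ →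
      ∀ k, 0 < k → IsZero (singularHomology ℚ ℚ W₁ k) ∧ IsZero (singularHomology ℚ ℚ W₂ k)

/-- **PBR from PABR modulo the cite-fact**: the two statements are equivalent modulo Etnyre's
theorem (the converse is `of_planarBisectionRigidity`). [folklore] -/
theorem planarBisectionRigidity_of (hE : PlanarImpliesAcyclic) (h : PlanarAcyclicBisectionRigidity) :
    PlanarBisectionRigidity := by
  intro M _ _ _ _ _ e hb
  obtain ⟨W₁, _, _, _, _, W₂, _, _, _, _, J₁, J₂, e₁, e₂, h₁, h₂, hcov, hs₁, hs₂, hξ, hpl⟩ := hb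
  exact h M e ⟨W₁, _, _, _, _, W₂, _, _, _, _, J₁, J₂, e₁, e₂, h₁, h₂, hcov, hs₁, hs₂, hξ,
    hE M e W₁ W₂ J₁ J₂ e₁ e₂ h₁ h₂ hcov hs₁ hs₂ hξ hpl, hpl⟩

/-! ## §3 Load-bearing analysis (junk exclusion for the planar conjunct) -/

/-- **A planar Stein domain has a boundary point**: an open book has `k ≥ 1` binding circles, which
live on the boundary datum's carrier `≅ ∂W`. So the EMPTY witness that refutes the
`M ≃ₕ S⁴`-deleted form of crux 2 (`AcyclicBisectionRigidity.Negative.not_crux_without_homotopyEquiv`)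
is NOT available for PABR: here an honest planar Stein domain (`B_{p,q}`, `S¹ × B³`) is required.
[folklore] -/
theorem boundary_nonempty_of_planar {W : Type} [TopologicalSpace W]
    [ChartedSpace (EuclideanHalfSpace 4) W] [IsManifold (𝓡∂ 4) ∞ W] [CompactSpace W]
    (J : SteinStructure W) (h : PlanarContactBoundary J) : ((𝓡∂ 4).boundary W).Nonempty := by
  obtain ⟨b, ob, -, -⟩ := h
  obtain ⟨y, -⟩ := ob.binding_nonempty
  exact ⟨b.incl y, b.incl_mem_boundary y⟩

/-- A manifold with a planar acyclic Stein bisection is nonempty (the first half has a boundary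
point). [folklore] -/
theorem nonempty_of_hasPlanarAcyclicSteinBisection {M : Type} [TopologicalSpace M]
    [ChartedSpace 𝔼4 M] (h : HasPlanarAcyclicSteinBisection M) : Nonempty M := by
  obtain ⟨W₁, _, _, _, _, W₂, _, _, _, _, J₁, J₂, e₁, e₂, -, -, -, -, -, -, -, hpl⟩ := h
  obtain ⟨x, -⟩ := boundary_nonempty_of_planar J₁ hpl
  exact ⟨e₁ x⟩

/-- **Dropping planarity gives crux 2 back, on the nose**: the `M ≃ₕ S⁴`-relative statement with
the planar conjunct deleted IS `AcyclicBisectionRigidity` (definitional). [folklore] -/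
theorem withoutPlanar_iff :
    (∀ (M : Type) [TopologicalSpace M] [T2Space M] [SecondCountableTopology M]
      [ChartedSpace 𝔼4 M] [IsManifold (𝓡 4) ∞ M], M ≃ₕ 𝕊⁴ →
      (∃ (W₁ : Type) (_ : TopologicalSpace W₁) (_ : ChartedSpace (EuclideanHalfSpace 4) W₁)
        (_ : IsManifold (𝓡∂ 4) ∞ W₁) (_ : CompactSpace W₁) (W₂ : Type) (_ : TopologicalSpace W₂)
        (_ : ChartedSpace (EuclideanHalfSpace 4) W₂) (_ : IsManifold (𝓡∂ 4) ∞ W₂) (_ : CompactSpace W₂)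
        (J₁ : SteinStructure W₁) (J₂ : SteinStructure W₂) (e₁ : W₁ → M) (e₂ : W₂ → M),
        Manifold.IsSmoothEmbedding (𝓡∂ 4) (𝓡 4) ∞ e₁ ∧ Manifold.IsSmoothEmbedding (𝓡∂ 4) (𝓡 4) ∞ e₂ ∧
        Set.range e₁ ∪ Set.range e₂ = Set.univ ∧
        Set.range e₁ ∩ Set.range e₂ = e₁ '' (𝓡∂ 4).boundary W₁ ∧
        Set.range e₁ ∩ Set.range e₂ = e₂ '' (𝓡∂ 4).boundary W₂ ∧
        (∀ w₁ w₂, e₁ w₁ = e₂ w₂ →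
          Submodule.map (mfderiv (𝓡∂ 4) (𝓡 4) e₁ w₁).toLinearMap (contactPlane J₁.J w₁) =
          Submodule.map (mfderiv (𝓡∂ 4) (𝓡 4) e₂ w₂).toLinearMap (contactPlane J₂.J w₂)) ∧
        (∀ k, 0 < k → IsZero (singularHomology ℚ ℚ W₁ k) ∧ IsZero (singularHomology ℚ ℚ W₂ k))) →
      Nonempty (M ≃ₘ⟮𝓡 4, 𝓡 4⟯ 𝕊⁴)) ↔ AcyclicBisectionRigidity :=
  Iff.rfl

/-! ## §L Line `Sketch` (k4-axis-calculus): the lever is TRUE, the ball-only lever is FALSE -/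

section Line

open Literature.Topology.FourManifolds.PlanarShadow

/-- **Total reduced length of a shadow state**: `Σᵢ |tᵢ|` (`FreeGroup.toWord` = the reduced word).
The potential of the descent. [folklore] -/
def totalLen (s : List F₂) : ℕ :=
  (s.map fun g => (FreeGroup.toWord g).length).sum

/-- **A state has a LINEARLY adjacent cancelling pair** `(…, a, a⁻¹, …)`. [folklore] -/
def AdjCancel (s : List F₂) : Prop :=
  ∃ (pre post : List F₂) (a : F₂), s = pre ++ a :: a⁻¹ :: post

/-- **THE DESCENT LEMMA** (as a `Prop`; PROVED ON PAPER here, formalisation = gap G-T).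
For every state `s` reachable from a start state: either `s` has a linearly adjacent cancelling
pair, or some single move (forward or inverse Hurwitz, at a linear position) strictly lowers the
total reduced length.

PROOF.  Let `s = (t₁, t₂, t₃, t₄)`; by the invariants of the walk `t₁t₂t₃t₄ = 1` and each `tᵢ` is a
conjugate of a generator `rᵢ ∈ {x, y, x⁻¹, y⁻¹}`; write its REDUCED word uniquely as `cᵢ rᵢ cᵢ⁻¹`
with `cᵢ` reduced and not ending in `rᵢ^{±1}`, so `|tᵢ| = 2|cᵢ| + 1`.  The concatenation
`ω = (c₁r₁c₁⁻¹)(c₂r₂c₂⁻¹)(c₃r₃c₃⁻¹)(c₄r₄c₄⁻¹)` freely reduces to the empty word, hence carries a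
complete NON-CROSSING matching `μ` of its letter positions pairing each letter with an inverse
letter (induction on the reduction); the letters strictly inside a matched pair are matched among
themselves, so that segment reduces to `ε`.  Call the positions of `r₁, …, r₄` RELATOR positions and
take a matched pair `(p, q)`, `p < q`, with a relator endpoint and minimal under nesting among such
pairs; no relator position lies strictly inside it (its arc would be nested inside).
(A) Both endpoints relators: then they are consecutive, `p = ρᵢ`, `q = ρᵢ₊₁`, the segment between is
`cᵢ⁻¹cᵢ₊₁ = ε`, so `cᵢ₊₁ = cᵢ` and `rᵢ₊₁ = rᵢ⁻¹`: `tᵢ₊₁ = tᵢ⁻¹`, an adjacent cancelling pair.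
(B) `p = ρᵢ`, `q` not a relator: `q` lies before `ρᵢ₊₁`, i.e. in `cᵢ⁻¹` or in `cᵢ₊₁` (for `i = 4`
only `c₄⁻¹` remains).  In `cᵢ⁻¹`: the segment between is a proper prefix of the reduced word
`cᵢ⁻¹`, empty, so `q = ρᵢ + 1` and the first letter of `cᵢ⁻¹` is `rᵢ⁻¹`, i.e. `cᵢ` ends in `rᵢ` —
excluded by the normalisation.  In `cᵢ₊₁` (`i ≤ 3`): `cᵢ₊₁ = e rᵢ⁻¹ f` with `cᵢ⁻¹ e = ε`, so
`e = cᵢ` and `cᵢ₊₁ = cᵢ rᵢ⁻¹ f`; the FORWARD move at `(i, i+1)` replaces `tᵢ₊₁` by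
`tᵢ tᵢ₊₁ tᵢ⁻¹ = (cᵢ f) rᵢ₊₁ (cᵢ f)⁻¹` (as `tᵢ cᵢ₊₁ = cᵢ rᵢ cᵢ⁻¹ cᵢ rᵢ⁻¹ f = cᵢ f`), of length
`≤ 2(|cᵢ| + |f|) + 1 = |tᵢ₊₁| − 2`, and keeps `tᵢ`: total length drops by `≥ 2`.
(C) `q = ρᵢ`, `p` not a relator: symmetrically `p` lies in `cᵢ` (excluded: `cᵢ` would end in
`rᵢ⁻¹`) or in `cᵢ₋₁⁻¹` (`i ≥ 2`): `cᵢ₋₁⁻¹ = f′ rᵢ⁻¹ e′` with `e′ cᵢ = ε`, so `cᵢ₋₁ = cᵢ rᵢ f′⁻¹`;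
the INVERSE move at `(i−1, i)` replaces `tᵢ₋₁` by `tᵢ⁻¹ tᵢ₋₁ tᵢ = (cᵢ f′⁻¹) rᵢ₋₁ (cᵢ f′⁻¹)⁻¹`, of
length `≤ |tᵢ₋₁| − 2`.  ∎  (Valid verbatim for identity sequences of ANY length over any free
basis: the classical collapsing argument for identity sequences over `⟨X ∣ X⟩`.)

RECOMMENDED FORMAL ROUTE (no matchings; one left-to-right induction over `FreeGroup.toWord`).
Call the junction `(i, i+1)` SHORT if the free cancellation between the reduced words of `tᵢ` and
`tᵢ₊₁` consumes at most `min(|cᵢ|, |cᵢ₊₁|)` letters on each side (it reaches neither `rᵢ` nor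
`rᵢ₊₁`).  (Y) If all three junctions are short then `t₁t₂t₃t₄ ≠ 1`: by induction on `k`,
`toWord (t₁⋯tₖ) = c₁ r₁ m₁₂ r₂ m₂₃ ⋯ rₖ cₖ⁻¹` with `mᵢ,ᵢ₊₁ = reduce (cᵢ⁻¹cᵢ₊₁)` — the junction
letters next to each `rⱼ` cannot cancel it precisely because the junctions are short (if
`cᵢ = z c′`, `cᵢ₊₁ = z c″` with `z` the longest common prefix, `mᵢ,ᵢ₊₁ = c′⁻¹ c″` is reduced and its
end letters are not `rᵢ^{∓1}`, `rᵢ₊₁^{∓1}` unless a junction is long; `c′ = c″ = ε` with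
`rᵢ₊₁ = rᵢ⁻¹` is a long junction too), so the reduced word keeps all `k` relator letters and is
non-empty (`FreeGroup.IsReduced.append_overlap` glues the pieces).  (X) A LONG junction `(i, i+1)`
gives the conclusion at once: if the cancellation reaches `rᵢ`, then either `cᵢ₊₁ = cᵢ rᵢ⁻¹ f`
(forward move shortens `tᵢ₊₁` by `≥ 2`), or `cᵢ₊₁ = cᵢ` and `rᵢ₊₁ = rᵢ⁻¹` (`AdjCancel`), or
`cᵢ = cᵢ₊₁ rᵢ₊₁ e` (inverse move at `(i, i+1)` replaces `tᵢ` by `tᵢ₊₁⁻¹tᵢtᵢ₊₁ = (cᵢ₊₁ e) rᵢ (cᵢ₊₁ e)⁻¹`,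
shorter by `≥ 2`); symmetrically if it reaches `rᵢ₊₁`.  Ingredients in Mathlib:
`FreeGroup.toWord_mul`, `toWord_inv`, `reduce`, `IsReduced` (+ `append_overlap`, `infix`), `norm`,
and the normal form `toWord t = c ++ [r] ++ invRev c` of a conjugate of a generator (from
`FreeGroup.reduceCyclically` / `conjugator`, file `CyclicallyReduced.lean`, or directly by
induction on the conjugator). [folklore] -/
def Descent : Prop :=
  ∀ (w : F₂) (P Q : F₂ × F₂) (s : List F₂), P ∈ XYPairs w → Q ∈ XYPairs w →
    Reachable (startState P Q) s →
      AdjCancel s ∨ ∃ s' : List F₂, (Move s s' ∨ Move s' s) ∧ totalLen s' < totalLen s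

/-- **THE TERMINAL TABLE** (as a `Prop`; PROVED ON PAPER here, formalisation = gap G-T).
A reachable state with a linearly adjacent cancelling pair reaches an honest `IsDoubleState`.

PROOF.  Reachable states are 4-lists with product `1` whose letters are one conjugate each of
`x, y, x⁻¹, y⁻¹` (a move conjugates one letter and permutes; the four classes are pairwise distinct
in `F₂`, as the abelianisation shows).  With an adjacent cancelling pair the state is, for `g` a
conjugate of `x` (resp. `y`) and `h` a conjugate of the other generator, one of the 16 rows below
(`t₁t₂ = 1 ⇔ t₃t₄ = 1`; `t₂t₃ = 1 ⇔ t₄t₁ = 1`), and the listed linear moves (`σᵢ` = forward Hurwitz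
move at position `i`, `σᵢ⁻¹` its inverse; uniform identities in the free group on `g, h`, checked by
`k4/terminal.py`) end in a literal `[p₁, p₂, p₂⁻¹, p₁⁻¹]` with `p₁, p₂` conjugates of `g`/`h`,
hence positive:
`[g,g⁻¹,h,h⁻¹] —σ₂σ₁→ [h,g,g⁻¹,h⁻¹]`; `[g,g⁻¹,h⁻¹,h] —σ₂σ₃σ₂→ [g, hᵍ, (hᵍ)⁻¹, g⁻¹]` (`hᵍ = g⁻¹hg`);
`[g⁻¹,g,h,h⁻¹] —σ₁σ₂σ₁→ [h,g,g⁻¹,h⁻¹]`; `[g⁻¹,g,h⁻¹,h] —σ₁σ₂σ₃σ₂→ [g, hᵍ, (hᵍ)⁻¹, g⁻¹]`;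
`[g,h,h⁻¹,g⁻¹]` (0 moves); `[g,h⁻¹,h,g⁻¹] —σ₂→ [g,h,h⁻¹,g⁻¹]`;
`[g⁻¹,h,h⁻¹,g] —σ₁σ₃⁻¹σ₂→ [hᵍ, g, g⁻¹, (hᵍ)⁻¹]`; `[g⁻¹,h⁻¹,h,g] —σ₂σ₁σ₃⁻¹σ₂→ [hᵍ, g, g⁻¹, (hᵍ)⁻¹]`;
and the same eight rows with the roles of `g` and `h` exchanged.  ∎ [folklore] -/
def Terminal : Prop :=
  ∀ (w : F₂) (P Q : F₂ × F₂) (s : List F₂), P ∈ XYPairs w → Q ∈ XYPairs w →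
    Reachable (startState P Q) s → AdjCancel s → ∃ t : List F₂, Reachable s t ∧ IsDoubleState t

/-- **K4-WALK FROM DESCENT AND THE TERMINAL TABLE** (kernel-checked strong induction on the total
reduced length): the lever `stub_shadowWalkK4` — with the DOUBLE target alone — follows from
`Descent` and `Terminal`.  This is the recommended proof route for the lead; the two-axis
structure of `w` is not needed. [folklore] -/
theorem lever_of_descent_of_terminal (hD : Descent) (hT : Terminal) (w : F₂) (P Q : F₂ × F₂)
    (hP : P ∈ XYPairs w) (hQ : Q ∈ XYPairs w) :
    ∃ t : List F₂, Reachable (startState P Q) t ∧ IsDoubleState t := by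
  suffices H : ∀ (n : ℕ) (s : List F₂), totalLen s = n → Reachable (startState P Q) s →
      ∃ t : List F₂, Reachable (startState P Q) t ∧ IsDoubleState t from
    H _ _ rfl (Reachable.refl _)
  intro n
  induction n using Nat.strong_induction_on with
  | _ n ih =>
    intro s hs hr
    rcases hD w P Q s hP hQ hr with hc | ⟨s', hm, hlt⟩
    · obtain ⟨t, hst, ht⟩ := hT w P Q s hP hQ hr hc
      exact ⟨t, hr.trans hst, ht⟩
    · exact ih (totalLen s') (hs ▸ hlt) s' rfl (hr.trans (Relation.ReflTransGen.single hm))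

/-- **The lever as registered** (ball OR double) from `Descent` and `Terminal`. [folklore] -/
theorem stub_shadowWalkK4_of_descent_of_terminal (hD : Descent) (hT : Terminal) (w : F₂)
    (P Q : F₂ × F₂) (hP : P ∈ XYPairs w) (hQ : Q ∈ XYPairs w) :
    ∃ t : List F₂, Reachable (startState P Q) t ∧ (IsBallState t ∨ IsDoubleState t) := by
  obtain ⟨t, ht, hd⟩ := lever_of_descent_of_terminal hD hT w P Q hP hQ
  exact ⟨t, ht, Or.inr hd⟩

/-- **THE BALL-ONLY LEVER** (natural strengthening; the predecessor line's target T1): every start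
state reaches a BALL state.  REFUTED: `Theorems/PlanarAcyclicBisectionRigidity/Negative/
ShadowBallUnreachable.lean` (proposal p100409), theorem `not_forall_reachable_isBallState` — the
`s`-twin word of length 18; obstruction = the subgroup generated by the letters is a move
invariant, is all of `F₂` at a ball state, and is of infinite index at that start state
(certificate `F₂ → S₃`, `x ↦ (1 2)`, `y ↦ (0 2)`). [folklore] -/
def BallOnlyLever : Prop :=
  ∀ (w : F₂) (P Q : F₂ × F₂), P ∈ XYPairs w → Q ∈ XYPairs w →
    ∃ t : List F₂, Reachable (startState P Q) t ∧ IsBallState t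

/-- **The subgroup invariant** (also in the Negative file): a move preserves "all letters lie in
`S`", both ways. [folklore] -/
theorem move_forall_mem_iff {S : Subgroup F₂} {s t : List F₂} (h : Move s t) :
    (∀ g ∈ s, g ∈ S) ↔ (∀ g ∈ t, g ∈ S) := by
  cases h with
  | hurwitz pre post a b =>
      simp only [List.forall_mem_append, List.forall_mem_cons]
      constructor
      · rintro ⟨hpre, ha, hb, hpost⟩
        exact ⟨hpre, S.mul_mem (S.mul_mem ha hb) (S.inv_mem ha), ha, hpost⟩
      · rintro ⟨hpre, hab, ha, hpost⟩
        refine ⟨hpre, ha, ?_, hpost⟩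
        have key : b = a⁻¹ * (a * b * a⁻¹) * a := by group
        rw [key]
        exact S.mul_mem (S.mul_mem (S.inv_mem ha) hab) ha
  | hurwitzInv pre post a b =>
      simp only [List.forall_mem_append, List.forall_mem_cons]
      constructor
      · rintro ⟨hpre, ha, hb, hpost⟩
        exact ⟨hpre, hb, S.mul_mem (S.mul_mem (S.inv_mem hb) ha) hb, hpost⟩
      · rintro ⟨hpre, hb, hba, hpost⟩
        refine ⟨hpre, ?_, hb, hpost⟩
        have key : a = b * (b⁻¹ * a * b) * b⁻¹ := by group
        rw [key]
        exact S.mul_mem (S.mul_mem hb hba) (S.inv_mem hb)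

/-- **Reachability preserves the subgroup generated by the letters** (containment form). [folklore] -/
theorem reachable_forall_mem {S : Subgroup F₂} {s t : List F₂} (h : Reachable s t)
    (hs : ∀ g ∈ s, g ∈ S) : ∀ g ∈ t, g ∈ S := by
  induction h with
  | refl => exact hs
  | tail _ hst ih =>
      rcases hst with hm | hm
      · exact (move_forall_mem_iff hm).1 ih
      · exact (move_forall_mem_iff hm).2 ih

/-- **The product of the letters is a move invariant** (used by `Descent`/`Terminal`: reachable
states have product `1`). [folklore] -/
theorem move_prod_eq {s t : List F₂} (h : Move s t) : s.prod = t.prod := by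
  cases h with
  | hurwitz pre post a b => simp [List.prod_append, mul_assoc]
  | hurwitzInv pre post a b => simp [List.prod_append, mul_assoc]

/-- Reachable states have the same product. [folklore] -/
theorem reachable_prod_eq {s t : List F₂} (h : Reachable s t) : s.prod = t.prod := by
  induction h with
  | refl => rfl
  | tail _ hst ih =>
      rcases hst with hm | hm
      · exact ih.trans (move_prod_eq hm)
      · exact ih.trans (move_prod_eq hm).symm

/-- The start state has product `1` (both pairs factorise the same `w`). [folklore] -/
theorem startState_prod {w : F₂} {P Q : F₂ × F₂} (hP : P ∈ XYPairs w) (hQ : Q ∈ XYPairs w) :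
    (startState P Q).prod = 1 := by
  obtain ⟨-, -, hP⟩ := hP
  obtain ⟨-, -, hQ⟩ := hQ
  simp only [startState, List.prod_cons, List.prod_nil, mul_one]
  rw [← mul_assoc, hP, ← hQ]
  group

/-- **Every reachable state has product `1`.** [folklore] -/
theorem prod_eq_one_of_reachable {w : F₂} {P Q : F₂ × F₂} (hP : P ∈ XYPairs w) (hQ : Q ∈ XYPairs w)
    {s : List F₂} (h : Reachable (startState P Q) s) : s.prod = 1 :=
  (reachable_prod_eq h).symm.trans (startState_prod hP hQ)

/-! ### §L-T The terminal table, PROVED (`terminal_holds : Terminal`) -/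

/-- Positivity is invariant under conjugation. [folklore] -/
theorem isPos_conj {a : F₂} (ha : IsPos a) (c : F₂) : IsPos (c * a * c⁻¹) := by
  obtain ⟨d, h | h⟩ := ha
  · exact ⟨c * d, Or.inl (by rw [h]; group)⟩
  · exact ⟨c * d, Or.inr (by rw [h]; group)⟩

/-- Positivity is invariant under conjugation (inverse on the left). [folklore] -/
theorem isPos_conj' {a : F₂} (ha : IsPos a) (c : F₂) : IsPos (c⁻¹ * a * c) := by
  simpa using isPos_conj ha c⁻¹

/-- Terminal row `row1`: `[g, g⁻¹, h, h⁻¹] ⟶ [h, g, g⁻¹, h⁻¹]` by `σ2 σ1`. [folklore] -/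
theorem row1 (g h : F₂) (hg : IsPos g) (hh : IsPos h) :
    ∃ t : List F₂, Reachable [g, g⁻¹, h, h⁻¹] t ∧ IsDoubleState t := by
  set u1 : F₂ := g⁻¹ * h * (g⁻¹)⁻¹ with hu1
  have m1 : Move [g, g⁻¹, h, h⁻¹] [g, u1, g⁻¹, h⁻¹] :=
    Move.hurwitz [g] [h⁻¹] (g⁻¹) (h)
  set u2 : F₂ := g * u1 * (g)⁻¹ with hu2
  have m2 : Move [g, u1, g⁻¹, h⁻¹] [u2, g, g⁻¹, h⁻¹] :=
    Move.hurwitz [] [g⁻¹, h⁻¹] (g) (u1)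
  have hfinal : [u2, g, g⁻¹, h⁻¹] = [h, g, g⁻¹, h⁻¹] := by
    simp only [hu2, hu1]
    refine List.cons_eq_cons.2 ⟨?_, List.cons_eq_cons.2 ⟨?_, List.cons_eq_cons.2 ⟨?_,
      List.cons_eq_cons.2 ⟨?_, rfl⟩⟩⟩⟩ <;> (first | rfl | group)
  refine ⟨_, hfinal ▸ (Move.reachable m1).trans (Move.reachable m2), h, g, hh, hg, rfl⟩

/-- Terminal row `row2`: `[g, g⁻¹, h⁻¹, h] ⟶ [g, g⁻¹ * h * g, (g⁻¹ * h * g)⁻¹, g⁻¹]` by `σ2 σ3 σ2`. [folklore] -/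
theorem row2 (g h : F₂) (hg : IsPos g) (hh : IsPos h) :
    ∃ t : List F₂, Reachable [g, g⁻¹, h⁻¹, h] t ∧ IsDoubleState t := by
  set u1 : F₂ := g⁻¹ * h⁻¹ * (g⁻¹)⁻¹ with hu1
  have m1 : Move [g, g⁻¹, h⁻¹, h] [g, u1, g⁻¹, h] :=
    Move.hurwitz [g] [h] (g⁻¹) (h⁻¹)
  set u2 : F₂ := g⁻¹ * h * (g⁻¹)⁻¹ with hu2
  have m2 : Move [g, u1, g⁻¹, h] [g, u1, u2, g⁻¹] :=
    Move.hurwitz [g, u1] [] (g⁻¹) (h)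
  set u3 : F₂ := u1 * u2 * (u1)⁻¹ with hu3
  have m3 : Move [g, u1, u2, g⁻¹] [g, u3, u1, g⁻¹] :=
    Move.hurwitz [g] [g⁻¹] (u1) (u2)
  have hfinal : [g, u3, u1, g⁻¹] = [g, g⁻¹ * h * g, (g⁻¹ * h * g)⁻¹, g⁻¹] := by
    simp only [hu3, hu2, hu1]
    refine List.cons_eq_cons.2 ⟨?_, List.cons_eq_cons.2 ⟨?_, List.cons_eq_cons.2 ⟨?_,
      List.cons_eq_cons.2 ⟨?_, rfl⟩⟩⟩⟩ <;> (first | rfl | group)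
  refine ⟨_, hfinal ▸ ((Move.reachable m1).trans (Move.reachable m2)).trans (Move.reachable m3), g, g⁻¹ * h * g, hg, isPos_conj' hh g, rfl⟩

/-- Terminal row `row3`: `[g⁻¹, g, h, h⁻¹] ⟶ [h, g, g⁻¹, h⁻¹]` by `σ1 σ2 σ1`. [folklore] -/
theorem row3 (g h : F₂) (hg : IsPos g) (hh : IsPos h) :
    ∃ t : List F₂, Reachable [g⁻¹, g, h, h⁻¹] t ∧ IsDoubleState t := by
  set u1 : F₂ := g⁻¹ * g * (g⁻¹)⁻¹ with hu1
  have m1 : Move [g⁻¹, g, h, h⁻¹] [u1, g⁻¹, h, h⁻¹] :=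
    Move.hurwitz [] [h, h⁻¹] (g⁻¹) (g)
  set u2 : F₂ := g⁻¹ * h * (g⁻¹)⁻¹ with hu2
  have m2 : Move [u1, g⁻¹, h, h⁻¹] [u1, u2, g⁻¹, h⁻¹] :=
    Move.hurwitz [u1] [h⁻¹] (g⁻¹) (h)
  set u3 : F₂ := u1 * u2 * (u1)⁻¹ with hu3
  have m3 : Move [u1, u2, g⁻¹, h⁻¹] [u3, u1, g⁻¹, h⁻¹] :=
    Move.hurwitz [] [g⁻¹, h⁻¹] (u1) (u2)
  have hfinal : [u3, u1, g⁻¹, h⁻¹] = [h, g, g⁻¹, h⁻¹] := by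
    simp only [hu3, hu2, hu1]
    refine List.cons_eq_cons.2 ⟨?_, List.cons_eq_cons.2 ⟨?_, List.cons_eq_cons.2 ⟨?_,
      List.cons_eq_cons.2 ⟨?_, rfl⟩⟩⟩⟩ <;> (first | rfl | group)
  refine ⟨_, hfinal ▸ ((Move.reachable m1).trans (Move.reachable m2)).trans (Move.reachable m3), h, g, hh, hg, rfl⟩

/-- Terminal row `row4`: `[g⁻¹, g, h⁻¹, h] ⟶ [g, g⁻¹ * h * g, (g⁻¹ * h * g)⁻¹, g⁻¹]` by `σ1 σ2 σ3 σ2`. [folklore] -/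
theorem row4 (g h : F₂) (hg : IsPos g) (hh : IsPos h) :
    ∃ t : List F₂, Reachable [g⁻¹, g, h⁻¹, h] t ∧ IsDoubleState t := by
  set u1 : F₂ := g⁻¹ * g * (g⁻¹)⁻¹ with hu1
  have m1 : Move [g⁻¹, g, h⁻¹, h] [u1, g⁻¹, h⁻¹, h] :=
    Move.hurwitz [] [h⁻¹, h] (g⁻¹) (g)
  set u2 : F₂ := g⁻¹ * h⁻¹ * (g⁻¹)⁻¹ with hu2
  have m2 : Move [u1, g⁻¹, h⁻¹, h] [u1, u2, g⁻¹, h] :=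
    Move.hurwitz [u1] [h] (g⁻¹) (h⁻¹)
  set u3 : F₂ := g⁻¹ * h * (g⁻¹)⁻¹ with hu3
  have m3 : Move [u1, u2, g⁻¹, h] [u1, u2, u3, g⁻¹] :=
    Move.hurwitz [u1, u2] [] (g⁻¹) (h)
  set u4 : F₂ := u2 * u3 * (u2)⁻¹ with hu4
  have m4 : Move [u1, u2, u3, g⁻¹] [u1, u4, u2, g⁻¹] :=
    Move.hurwitz [u1] [g⁻¹] (u2) (u3)
  have hfinal : [u1, u4, u2, g⁻¹] = [g, g⁻¹ * h * g, (g⁻¹ * h * g)⁻¹, g⁻¹] := by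
    simp only [hu4, hu3, hu2, hu1]
    refine List.cons_eq_cons.2 ⟨?_, List.cons_eq_cons.2 ⟨?_, List.cons_eq_cons.2 ⟨?_,
      List.cons_eq_cons.2 ⟨?_, rfl⟩⟩⟩⟩ <;> (first | rfl | group)
  refine ⟨_, hfinal ▸ (((Move.reachable m1).trans (Move.reachable m2)).trans (Move.reachable m3)).trans (Move.reachable m4), g, g⁻¹ * h * g, hg, isPos_conj' hh g, rfl⟩

/-- Terminal row `row6`: `[g, h⁻¹, h, g⁻¹] ⟶ [g, h, h⁻¹, g⁻¹]` by `σ2`. [folklore] -/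
theorem row6 (g h : F₂) (hg : IsPos g) (hh : IsPos h) :
    ∃ t : List F₂, Reachable [g, h⁻¹, h, g⁻¹] t ∧ IsDoubleState t := by
  set u1 : F₂ := h⁻¹ * h * (h⁻¹)⁻¹ with hu1
  have m1 : Move [g, h⁻¹, h, g⁻¹] [g, u1, h⁻¹, g⁻¹] :=
    Move.hurwitz [g] [g⁻¹] (h⁻¹) (h)
  have hfinal : [g, u1, h⁻¹, g⁻¹] = [g, h, h⁻¹, g⁻¹] := by
    simp only [hu1]
    refine List.cons_eq_cons.2 ⟨?_, List.cons_eq_cons.2 ⟨?_, List.cons_eq_cons.2 ⟨?_,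
      List.cons_eq_cons.2 ⟨?_, rfl⟩⟩⟩⟩ <;> (first | rfl | group)
  refine ⟨_, hfinal ▸ Move.reachable m1, g, h, hg, hh, rfl⟩

/-- Terminal row `row7`: `[g⁻¹, h, h⁻¹, g] ⟶ [g⁻¹ * h * g, g, g⁻¹, (g⁻¹ * h * g)⁻¹]` by `σ1 σ3⁻¹ σ2`. [folklore] -/
theorem row7 (g h : F₂) (hg : IsPos g) (hh : IsPos h) :
    ∃ t : List F₂, Reachable [g⁻¹, h, h⁻¹, g] t ∧ IsDoubleState t := by
  set u1 : F₂ := g⁻¹ * h * (g⁻¹)⁻¹ with hu1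
  have m1 : Move [g⁻¹, h, h⁻¹, g] [u1, g⁻¹, h⁻¹, g] :=
    Move.hurwitz [] [h⁻¹, g] (g⁻¹) (h)
  set u2 : F₂ := (g)⁻¹ * h⁻¹ * g with hu2
  have m2 : Move [u1, g⁻¹, h⁻¹, g] [u1, g⁻¹, g, u2] :=
    Move.hurwitzInv [u1, g⁻¹] [] (h⁻¹) (g)
  set u3 : F₂ := g⁻¹ * g * (g⁻¹)⁻¹ with hu3
  have m3 : Move [u1, g⁻¹, g, u2] [u1, u3, g⁻¹, u2] :=
    Move.hurwitz [u1] [u2] (g⁻¹) (g)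
  have hfinal : [u1, u3, g⁻¹, u2] = [g⁻¹ * h * g, g, g⁻¹, (g⁻¹ * h * g)⁻¹] := by
    simp only [hu3, hu2, hu1]
    refine List.cons_eq_cons.2 ⟨?_, List.cons_eq_cons.2 ⟨?_, List.cons_eq_cons.2 ⟨?_,
      List.cons_eq_cons.2 ⟨?_, rfl⟩⟩⟩⟩ <;> (first | rfl | group)
  refine ⟨_, hfinal ▸ ((Move.reachable m1).trans (Move.reachable m2)).trans (Move.reachable m3), g⁻¹ * h * g, g, isPos_conj' hh g, hg, rfl⟩

/-- Terminal row `row8`: `[g⁻¹, h⁻¹, h, g] ⟶ [g⁻¹ * h * g, g, g⁻¹, (g⁻¹ * h * g)⁻¹]` by `σ2 σ1 σ3⁻¹ σ2`. [folklore] -/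
theorem row8 (g h : F₂) (hg : IsPos g) (hh : IsPos h) :
    ∃ t : List F₂, Reachable [g⁻¹, h⁻¹, h, g] t ∧ IsDoubleState t := by
  set u1 : F₂ := h⁻¹ * h * (h⁻¹)⁻¹ with hu1
  have m1 : Move [g⁻¹, h⁻¹, h, g] [g⁻¹, u1, h⁻¹, g] :=
    Move.hurwitz [g⁻¹] [g] (h⁻¹) (h)
  set u2 : F₂ := g⁻¹ * u1 * (g⁻¹)⁻¹ with hu2
  have m2 : Move [g⁻¹, u1, h⁻¹, g] [u2, g⁻¹, h⁻¹, g] :=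
    Move.hurwitz [] [h⁻¹, g] (g⁻¹) (u1)
  set u3 : F₂ := (g)⁻¹ * h⁻¹ * g with hu3
  have m3 : Move [u2, g⁻¹, h⁻¹, g] [u2, g⁻¹, g, u3] :=
    Move.hurwitzInv [u2, g⁻¹] [] (h⁻¹) (g)
  set u4 : F₂ := g⁻¹ * g * (g⁻¹)⁻¹ with hu4
  have m4 : Move [u2, g⁻¹, g, u3] [u2, u4, g⁻¹, u3] :=
    Move.hurwitz [u2] [u3] (g⁻¹) (g)
  have hfinal : [u2, u4, g⁻¹, u3] = [g⁻¹ * h * g, g, g⁻¹, (g⁻¹ * h * g)⁻¹] := by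
    simp only [hu4, hu3, hu2, hu1]
    refine List.cons_eq_cons.2 ⟨?_, List.cons_eq_cons.2 ⟨?_, List.cons_eq_cons.2 ⟨?_,
      List.cons_eq_cons.2 ⟨?_, rfl⟩⟩⟩⟩ <;> (first | rfl | group)
  refine ⟨_, hfinal ▸ (((Move.reachable m1).trans (Move.reachable m2)).trans (Move.reachable m3)).trans (Move.reachable m4), g⁻¹ * h * g, g, isPos_conj' hh g, hg, rfl⟩


/-- Row 5 is already an honest double. [folklore] -/
theorem row5 (g h : F₂) (hg : IsPos g) (hh : IsPos h) :
    ∃ t : List F₂, Reachable [g, h, h⁻¹, g⁻¹] t ∧ IsDoubleState t :=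
  ⟨_, Reachable.refl _, g, h, hg, hh, rfl⟩

/-- **Every letter of a state is positive or the inverse of a positive element** — the SIGNED
shape invariant of the walk. [folklore] -/
def AllSigned (s : List F₂) : Prop :=
  ∀ g ∈ s, IsPos g ∨ IsPos g⁻¹

/-- A signed letter stays signed under conjugation. [folklore] -/
theorem signed_conj {b : F₂} (hb : IsPos b ∨ IsPos b⁻¹) (a : F₂) :
    IsPos (a * b * a⁻¹) ∨ IsPos (a * b * a⁻¹)⁻¹ := by
  rcases hb with hb | hb
  · exact Or.inl (isPos_conj hb a)
  · right
    have e : (a * b * a⁻¹)⁻¹ = a * b⁻¹ * a⁻¹ := by group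
    rw [e]
    exact isPos_conj hb a

/-- The signed shape is invariant under a move, both ways. [folklore] -/
theorem move_allSigned_iff {s t : List F₂} (h : Move s t) : AllSigned s ↔ AllSigned t := by
  cases h with
  | hurwitz pre post a b =>
      simp only [AllSigned, List.forall_mem_append, List.forall_mem_cons]
      constructor
      · rintro ⟨hpre, ha, hb, hpost⟩
        exact ⟨hpre, signed_conj hb a, ha, hpost⟩
      · rintro ⟨hpre, hab, ha, hpost⟩
        refine ⟨hpre, ha, ?_, hpost⟩
        have e : b = a⁻¹ * (a * b * a⁻¹) * a⁻¹⁻¹ := by group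
        rw [e]
        exact signed_conj hab a⁻¹
  | hurwitzInv pre post a b =>
      simp only [AllSigned, List.forall_mem_append, List.forall_mem_cons]
      constructor
      · rintro ⟨hpre, ha, hb, hpost⟩
        refine ⟨hpre, hb, ?_, hpost⟩
        have e : b⁻¹ * a * b = b⁻¹ * a * b⁻¹⁻¹ := by group
        rw [e]
        exact signed_conj ha b⁻¹
      · rintro ⟨hpre, hb, hba, hpost⟩
        refine ⟨hpre, ?_, hb, hpost⟩
        have e : a = b * (b⁻¹ * a * b) * b⁻¹ := by group
        rw [e]
        exact signed_conj hba b

/-- Reachability preserves the signed shape. [folklore] -/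
theorem reachable_allSigned {s t : List F₂} (h : Reachable s t) (hs : AllSigned s) : AllSigned t := by
  induction h with
  | refl => exact hs
  | tail _ hst ih =>
      rcases hst with hm | hm
      · exact (move_allSigned_iff hm).1 ih
      · exact (move_allSigned_iff hm).2 ih

/-- The start state is signed: `(+, +, −, −)`. [folklore] -/
theorem startState_allSigned {w : F₂} {P Q : F₂ × F₂} (hP : P ∈ XYPairs w) (hQ : Q ∈ XYPairs w) :
    AllSigned (startState P Q) := by
  obtain ⟨⟨c₁, h₁⟩, ⟨c₂, h₂⟩, -⟩ := hP
  obtain ⟨⟨d₁, k₁⟩, ⟨d₂, k₂⟩, -⟩ := hQ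
  intro g hg
  simp only [startState, List.mem_cons, List.not_mem_nil, or_false] at hg
  rcases hg with rfl | rfl | rfl | rfl
  · exact Or.inl ⟨c₁, Or.inl h₁⟩
  · exact Or.inl ⟨c₂, Or.inr h₂⟩
  · exact Or.inr ⟨d₂, Or.inr (by rw [inv_inv]; exact k₂)⟩
  · exact Or.inr ⟨d₁, Or.inl (by rw [inv_inv]; exact k₁)⟩

/-- A move preserves the length of the state. [folklore] -/
theorem move_length_eq {s t : List F₂} (h : Move s t) : s.length = t.length := by
  cases h <;> simp

/-- Reachability preserves the length of the state. [folklore] -/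
theorem reachable_length_eq {s t : List F₂} (h : Reachable s t) : s.length = t.length := by
  induction h with
  | refl => rfl
  | tail _ hst ih =>
      rcases hst with hm | hm
      · exact ih.trans (move_length_eq hm)
      · exact ih.trans (move_length_eq hm).symm

/-- **The four-row dispatch for the shape `[a, a⁻¹, c, c⁻¹]`.** [folklore] -/
theorem terminal_shape₀ {a c : F₂} (ha : IsPos a ∨ IsPos a⁻¹) (hc : IsPos c ∨ IsPos c⁻¹) :
    ∃ t : List F₂, Reachable [a, a⁻¹, c, c⁻¹] t ∧ IsDoubleState t := by
  rcases ha with ha | ha <;> rcases hc with hc | hc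
  · exact row1 a c ha hc
  · simpa using row2 a c⁻¹ ha hc
  · simpa using row3 a⁻¹ c ha hc
  · simpa using row4 a⁻¹ c⁻¹ ha hc

/-- **The four-row dispatch for the shape `[b, a, a⁻¹, b⁻¹]`.** [folklore] -/
theorem terminal_shape₁ {a b : F₂} (ha : IsPos a ∨ IsPos a⁻¹) (hb : IsPos b ∨ IsPos b⁻¹) :
    ∃ t : List F₂, Reachable [b, a, a⁻¹, b⁻¹] t ∧ IsDoubleState t := by
  rcases hb with hb | hb <;> rcases ha with ha | ha
  · exact row5 b a hb ha
  · simpa using row6 b a⁻¹ hb ha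
  · simpa using row7 b⁻¹ a hb ha
  · simpa using row8 b⁻¹ a⁻¹ hb ha

/-- **THE TERMINAL TABLE HOLDS** (`Terminal`, machine-checked): a reachable state with a linearly
adjacent cancelling pair reaches an honest `IsDoubleState`.  With `lever_of_descent_of_terminal`,
the lever `stub_shadowWalkK4` is now reduced to the single statement `Descent`. [folklore] -/
theorem terminal_holds : Terminal := by
  intro w P Q s hP hQ hr hc
  have hprod : s.prod = 1 := prod_eq_one_of_reachable hP hQ hr
  have hlen : s.length = 4 := by rw [← reachable_length_eq hr]; rfl
  have hsgn : AllSigned s := reachable_allSigned hr (startState_allSigned hP hQ)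
  obtain ⟨pre, post, a, rfl⟩ := hc
  have hsgn' := hsgn
  simp only [AllSigned, List.forall_mem_append, List.forall_mem_cons] at hsgn'
  obtain ⟨hpre, ha, -, hpost⟩ := hsgn'
  rcases pre with _ | ⟨b, _ | ⟨c, _ | ⟨d, pre⟩⟩⟩
  · -- shape [a, a⁻¹, c, d]
    rcases post with _ | ⟨c, _ | ⟨d, _ | ⟨e, post⟩⟩⟩ <;> simp at hlen
    have hcd : c * d = 1 := by simpa [List.prod_cons, List.prod_nil] using hprod
    obtain rfl : d = c⁻¹ := eq_inv_of_mul_eq_one_right hcd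
    exact terminal_shape₀ ha (hpost c (by simp))
  · -- shape [b, a, a⁻¹, d]
    rcases post with _ | ⟨d, _ | ⟨e, post⟩⟩ <;> simp at hlen
    have hbd : b * d = 1 := by simpa [List.prod_cons, List.prod_nil] using hprod
    obtain rfl : d = b⁻¹ := eq_inv_of_mul_eq_one_right hbd
    exact terminal_shape₁ ha (hpre b (by simp))
  · -- shape [b, c, a, a⁻¹]
    rcases post with _ | ⟨d, post⟩ <;> simp at hlen
    have hbc : b * c = 1 := by simpa [List.prod_cons, List.prod_nil] using hprod
    obtain rfl : c = b⁻¹ := eq_inv_of_mul_eq_one_right hbc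
    exact terminal_shape₀ (hpre b (by simp)) ha
  · rw [List.length_append] at hlen
    simp only [List.length_cons] at hlen
    omega

/-- **THE LEVER MODULO DESCENT ALONE** (double target): `Descent → ∀ w P Q ∈ XYPairs w, ∃ t,
Reachable (startState P Q) t ∧ IsDoubleState t`. [folklore] -/
theorem lever_of_descent (hD : Descent) (w : F₂) (P Q : F₂ × F₂) (hP : P ∈ XYPairs w)
    (hQ : Q ∈ XYPairs w) : ∃ t : List F₂, Reachable (startState P Q) t ∧ IsDoubleState t :=
  lever_of_descent_of_terminal hD terminal_holds w P Q hP hQ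

/-- **`stub_shadowWalkK4` modulo `Descent`** (verbatim the registered signature's conclusion).
[folklore] -/
theorem stub_shadowWalkK4_of_descent (hD : Descent) (w : F₂) (P Q : F₂ × F₂)
    (hP : P ∈ XYPairs w) (hQ : Q ∈ XYPairs w) :
    ∃ t : List F₂, Reachable (startState P Q) t ∧ (IsBallState t ∨ IsDoubleState t) :=
  stub_shadowWalkK4_of_descent_of_terminal hD terminal_holds w P Q hP hQ

/-! ### §L-D The descent lemma, PROVED (`descent_holds : Descent`)

Reduced words (`FreeGroup.toWord`), the conjugate normal form `c ++ [r] ++ c⁻¹` of a signed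
letter, the longest common prefix of two conjugators, the SHORT/LONG junction trichotomy, the
gluing step of the left-to-right reduction, and the assembly. -/

section DescentProof

open FreeGroup

/-- Letters of `F₂`-words: a generator index and a sign. [folklore] -/
abbrev Ltr : Type := Fin 2 × Bool

/-- The inverse letter. [folklore] -/
def linv (a : Ltr) : Ltr := (a.1, !a.2)

@[simp] theorem linv_fst (a : Ltr) : (linv a).1 = a.1 := rfl
@[simp] theorem linv_snd (a : Ltr) : (linv a).2 = !a.2 := rfl
@[simp] theorem linv_linv (a : Ltr) : linv (linv a) = a := by simp [linv]

/-- `invRev` of a singleton. [folklore] -/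
@[simp] theorem invRev_singleton (a : Ltr) : invRev [a] = [linv a] := by simp [invRev, linv]

/-- `invRev` of a cons, with the inverse letter spelled `linv`. [folklore] -/
theorem invRev_cons_eq (a : Ltr) (L : List Ltr) : invRev (a :: L) = invRev L ++ [linv a] := by
  rw [FreeGroup.invRev_cons, invRev_singleton]

/-- `mk [linv r] = (mk [r])⁻¹`. [folklore] -/
theorem mk_linv (r : Ltr) : (FreeGroup.mk [linv r] : F₂) = (FreeGroup.mk [r])⁻¹ := by
  rw [FreeGroup.inv_mk, invRev_singleton]

/-- Reducedness of a concatenation (Mathlib's `List.isChain_append`, respelled). [folklore] -/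
theorem isReduced_append_iff {L₁ L₂ : List Ltr} :
    IsReduced (L₁ ++ L₂) ↔ IsReduced L₁ ∧ IsReduced L₂ ∧
      ∀ a ∈ L₁.getLast?, ∀ b ∈ L₂.head?, a.1 = b.1 → a.2 = b.2 :=
  List.isChain_append

/-- **Conjugate normal form**: the reduced word of `g` is `c ++ [r] ++ c⁻¹` and the conjugator `c`
does not end with a letter on the generator of `r`. [folklore] -/
structure CNF (c : List Ltr) (r : Ltr) (g : F₂) : Prop where
  /-- the reduced word -/
  toWord_eq : g.toWord = c ++ r :: invRev c
  /-- the normalisation of the conjugator -/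
  last_ne : ∀ a ∈ c.getLast?, a.1 ≠ r.1

/-- The length of a letter in conjugate normal form is `2|c| + 1`. [folklore] -/
theorem CNF.norm_eq {c : List Ltr} {r : Ltr} {g : F₂} (h : CNF c r g) : g.norm = 2 * c.length + 1 := by
  simp [FreeGroup.norm, h.toWord_eq]
  omega

/-- A letter in conjugate normal form as a product of `mk`'s. [folklore] -/
theorem CNF.eq_mk {c : List Ltr} {r : Ltr} {g : F₂} (h : CNF c r g) :
    g = FreeGroup.mk c * FreeGroup.mk [r] * (FreeGroup.mk c)⁻¹ := by
  rw [FreeGroup.inv_mk, FreeGroup.mul_mk, FreeGroup.mul_mk, List.append_assoc, List.singleton_append,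
    ← h.toWord_eq, FreeGroup.mk_toWord]

/-- The inverse of a letter in conjugate normal form. [folklore] -/
theorem CNF.inv {c : List Ltr} {r : Ltr} {g : F₂} (h : CNF c r g) : CNF c (linv r) g⁻¹ where
  toWord_eq := by
    rw [FreeGroup.toWord_inv, h.toWord_eq]
    simp [FreeGroup.invRev_append, invRev_cons_eq, FreeGroup.invRev_invRev]
  last_ne := by simpa using h.last_ne

/-- The reduced word of a letter in conjugate normal form is reduced (restatement). [folklore] -/
theorem CNF.isReduced {c : List Ltr} {r : Ltr} {g : F₂} (h : CNF c r g) :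
    IsReduced (c ++ r :: invRev c) := by
  rw [← h.toWord_eq]
  exact FreeGroup.isReduced_toWord

/-- Two one-letter words on the same generator commute past each other:
`a r a⁻¹ = r` when `a.1 = r.1`. [folklore] -/
theorem mk_conj_same_gen (a r : Ltr) (har : a.1 = r.1) :
    FreeGroup.mk [a] * FreeGroup.mk [r] * (FreeGroup.mk [a])⁻¹ = (FreeGroup.mk [r] : F₂) := by
  obtain ⟨i, b⟩ := a
  obtain ⟨j, b'⟩ := r
  simp only at har
  subst har
  cases b <;> cases b' <;>
    simp [FreeGroup.inv_mk, FreeGroup.invRev, FreeGroup.mul_mk, ← FreeGroup.toWord_inj,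
      FreeGroup.toWord_mk, FreeGroup.reduce]

/-- **Existence of the conjugate normal form** for a conjugate of a one-letter word (induction on
the length of the conjugator: trailing letters on the generator of `r` are absorbed). [folklore] -/
theorem exists_cnf (r : Ltr) : ∀ (n : ℕ) (d : F₂), d.norm = n →
    ∃ c : List Ltr, CNF c r (d * FreeGroup.mk [r] * d⁻¹) := by
  intro n
  induction n using Nat.strong_induction_on with
  | _ n ih =>
    intro d hd
    set L := d.toWord with hLdef
    have hdL : d = FreeGroup.mk L := FreeGroup.mk_toWord.symm
    have hLred : IsReduced L := FreeGroup.isReduced_toWord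
    rcases L.eq_nil_or_concat with hL | ⟨L', a, hL⟩
    · -- `d = 1`
      refine ⟨[], ?_, by simp⟩
      have hd1 : d = 1 := by rw [hdL, hL]; rfl
      rw [hd1, one_mul, inv_one, mul_one, FreeGroup.toWord_mk]
      rfl
    · rw [List.concat_eq_append] at hL
      by_cases har : a.1 = r.1
      · -- absorb the trailing letter: `mk [a]` commutes with `mk [r]`
        have hd' : d = FreeGroup.mk L' * FreeGroup.mk [a] := by
          rw [FreeGroup.mul_mk, ← hL]; exact hdL
        have hlt : (FreeGroup.mk L' : F₂).norm < n := by
          have h1 : (FreeGroup.mk L' : F₂).norm ≤ L'.length := FreeGroup.norm_mk_le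
          have h2 : d.norm = L'.length + 1 := by
            rw [FreeGroup.norm, ← hLdef, hL]; simp
          omega
        obtain ⟨c, hc⟩ := ih _ hlt (FreeGroup.mk L') rfl
        refine ⟨c, ?_⟩
        have : d * FreeGroup.mk [r] * d⁻¹ =
            FreeGroup.mk L' * FreeGroup.mk [r] * (FreeGroup.mk L')⁻¹ := by
          rw [hd', mul_inv_rev]
          have e : FreeGroup.mk L' * FreeGroup.mk [a] * FreeGroup.mk [r] *
              ((FreeGroup.mk [a])⁻¹ * (FreeGroup.mk L')⁻¹) =
              FreeGroup.mk L' * (FreeGroup.mk [a] * FreeGroup.mk [r] * (FreeGroup.mk [a])⁻¹) *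
                (FreeGroup.mk L')⁻¹ := by group
          rw [e, mk_conj_same_gen a r har]
        rw [this]
        exact hc
      · -- the word `L ++ [r] ++ L⁻¹` is already reduced
        refine ⟨L, ?_, ?_⟩
        · have hg : d * FreeGroup.mk [r] * d⁻¹ = FreeGroup.mk (L ++ r :: invRev L) := by
            rw [hdL, FreeGroup.inv_mk, FreeGroup.mul_mk, FreeGroup.mul_mk, List.append_assoc,
              List.singleton_append]
          rw [hg, FreeGroup.toWord_mk]
          apply FreeGroup.IsReduced.reduce_eq
          rw [isReduced_append_iff]
          refine ⟨hLred, ?_, ?_⟩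
          · rw [hL, FreeGroup.invRev_append, invRev_singleton, List.singleton_append,
              FreeGroup.isReduced_cons_cons]
            refine ⟨fun h => absurd h.symm (by simpa using har), ?_⟩
            have hinv : IsReduced (invRev L) := by
              rw [hLdef, ← FreeGroup.toWord_inv]; exact FreeGroup.isReduced_toWord
            rw [hL, FreeGroup.invRev_append, invRev_singleton, List.singleton_append] at hinv
            exact hinv
          · intro x hx y hy hxy
            rw [hL, List.getLast?_concat] at hx
            simp only [Option.mem_def, Option.some.injEq] at hx
            simp only [List.head?_cons, Option.mem_def, Option.some.injEq] at hy
            subst hx; subst hy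
            exact absurd hxy har
        · intro x hx
          rw [hL, List.getLast?_concat] at hx
          simp only [Option.mem_def, Option.some.injEq] at hx
          subst hx
          exact har

/-- Every signed letter has a conjugate normal form on some generator letter. [folklore] -/
theorem exists_cnf_of_signed {g : F₂} (hg : IsPos g ∨ IsPos g⁻¹) :
    ∃ (c : List Ltr) (r : Ltr), CNF c r g := by
  have key : ∀ (d : F₂) (r : Ltr), ∃ c, CNF c r (d * FreeGroup.mk [r] * d⁻¹) :=
    fun d r => exists_cnf r _ d rfl
  rcases hg with ⟨d, h | h⟩ | ⟨d, h | h⟩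
  · obtain ⟨c, hc⟩ := key d (0, true)
    exact ⟨c, (0, true), by rw [h]; exact hc⟩
  · obtain ⟨c, hc⟩ := key d (1, true)
    exact ⟨c, (1, true), by rw [h]; exact hc⟩
  · obtain ⟨c, hc⟩ := key d (0, true)
    have h1 : CNF c (0, true) g⁻¹ := by rw [h]; exact hc
    have h2 := h1.inv
    rw [inv_inv] at h2
    exact ⟨c, (0, false), h2⟩
  · obtain ⟨c, hc⟩ := key d (1, true)
    have h1 : CNF c (1, true) g⁻¹ := by rw [h]; exact hc
    have h2 := h1.inv
    rw [inv_inv] at h2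
    exact ⟨c, (1, false), h2⟩

/-! #### The longest common prefix of two conjugators -/

/-- Longest common prefix. [folklore] -/
def lcp : List Ltr → List Ltr → List Ltr
  | a :: l, b :: m => if a = b then a :: lcp l m else []
  | _, _ => []

/-- **Decomposition along the longest common prefix**: `l = z ++ l'`, `m = z ++ m'` with distinct
first letters of the remainders (when both are non-empty). [folklore] -/
theorem lcp_spec : ∀ (l m : List Ltr), ∃ l' m' : List Ltr, l = lcp l m ++ l' ∧ m = lcp l m ++ m' ∧
    ∀ a ∈ l'.head?, ∀ b ∈ m'.head?, a ≠ b
  | [], m => ⟨[], m, by cases m <;> rfl, by cases m <;> rfl, by simp⟩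
  | a :: l, [] => ⟨a :: l, [], rfl, rfl, by simp⟩
  | a :: l, b :: m => by
      by_cases h : a = b
      · subst h
        obtain ⟨l', m', hl, hm, hne⟩ := lcp_spec l m
        have e : lcp (a :: l) (a :: m) = a :: lcp l m := by simp [lcp]
        refine ⟨l', m', ?_, ?_, hne⟩
        · rw [e, List.cons_append, ← hl]
        · rw [e, List.cons_append, ← hm]
      · have e : lcp (a :: l) (b :: m) = [] := by simp [lcp, h]
        exact ⟨a :: l, b :: m, by rw [e]; rfl, by rw [e]; rfl, by simpa using h⟩

/-! #### The junction trichotomy -/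

/-- **SHORT or LONG junction** between consecutive letters in conjugate normal forms `(c, r)` and
`(c′, r′)`: either the cancellation reaches `r` from the right (`long₁`), or the two letters are
mutually inverse (`cancel`), or the cancellation reaches `r′` from the left (`long₃`), or the
junction is SHORT: with `z` the longest common prefix, `c = z ++ c₁`, `c′ = z ++ c₂` and the bridge
word `r c₁⁻¹ c₂ r′` is reduced. [folklore] -/
inductive Junction (c : List Ltr) (r : Ltr) (c' : List Ltr) (r' : Ltr) : Prop
  | long₁ (f : List Ltr) (h : c' = c ++ linv r :: f) : Junction c r c' r'
  | cancel (hc : c' = c) (hr : r' = linv r) : Junction c r c' r'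
  | long₃ (e : List Ltr) (h : c = c' ++ r' :: e) : Junction c r c' r'
  | short (z c₁ c₂ : List Ltr) (hc : c = z ++ c₁) (hc' : c' = z ++ c₂)
      (hred : IsReduced ((r :: invRev c₁) ++ (c₂ ++ [r']))) : Junction c r c' r'

/-- Two distinct letters on the same generator are mutually inverse. [folklore] -/
theorem eq_linv_of_ne {a b : Ltr} (hne : a ≠ b) (h1 : a.1 = b.1) : b = linv a := by
  obtain ⟨i, x⟩ := a
  obtain ⟨j, y⟩ := b
  simp only at h1
  subst h1
  have : x ≠ y := fun h => hne (by rw [h])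
  cases x <;> cases y <;> simp_all [linv]

/-- The reducedness condition between two letters that are not mutually inverse. [folklore] -/
theorem red_pair_of_ne_linv {a b : Ltr} (h : b ≠ linv a) : a.1 = b.1 → a.2 = b.2 := by
  intro h1
  by_cases hab : a = b
  · rw [hab]
  · exact absurd (eq_linv_of_ne hab h1) h

/-- **The trichotomy holds for every pair of letters in conjugate normal form.** [folklore] -/
theorem junction {c c' : List Ltr} {r r' : Ltr} {t t' : F₂} (ht : CNF c r t) (ht' : CNF c' r' t') :
    Junction c r c' r' := by
  obtain ⟨c₁, c₂, hc, hc', hne⟩ := lcp_spec c c'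
  set z := lcp c c' with hz
  -- reducedness of the two tails, as infixes of the reduced words of `t` and `t'`
  have hred₁ : IsReduced (r :: invRev c₁) := by
    have h := ht.isReduced
    rw [hc, FreeGroup.invRev_append] at h
    exact h.infix ⟨z ++ c₁, invRev z, by simp⟩
  have hred₂ : IsReduced (c₂ ++ [r']) := by
    have h := ht'.isReduced
    rw [hc'] at h
    exact h.infix ⟨z, invRev (z ++ c₂), by simp⟩
  rcases c₁ with _ | ⟨a, e⟩ <;> rcases c₂ with _ | ⟨b, f⟩
  · -- `c = c'`: cancel or short
    simp only [List.append_nil] at hc hc'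
    by_cases hr : r' = linv r
    · exact Junction.cancel (hc'.trans hc.symm) hr
    · refine Junction.short z [] [] (by simpa using hc) (by simpa using hc') ?_
      simpa [FreeGroup.invRev_empty] using red_pair_of_ne_linv hr
  · -- `c' = c ++ b :: f`: long₁ or short
    simp only [List.append_nil] at hc
    by_cases hb : b = linv r
    · exact Junction.long₁ f (by rw [hc', hc, hb])
    · refine Junction.short z [] (b :: f) (by simpa using hc) hc' ?_
      have e1 : (r :: invRev ([] : List Ltr)) ++ (b :: f ++ [r']) = r :: b :: (f ++ [r']) := by
        simp [FreeGroup.invRev_empty]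
      rw [e1, FreeGroup.isReduced_cons_cons]
      exact ⟨red_pair_of_ne_linv hb, by simpa using hred₂⟩
  · -- `c = c' ++ a :: e`: long₃ or short
    simp only [List.append_nil] at hc'
    by_cases ha : a = r'
    · exact Junction.long₃ e (by rw [hc, hc', ha])
    · refine Junction.short z (a :: e) [] hc (by simpa using hc') ?_
      rw [isReduced_append_iff]
      refine ⟨hred₁, by simp, ?_⟩
      intro x hx y hy
      have exl : (r :: invRev (a :: e)).getLast? = some (linv a) := by
        rw [invRev_cons_eq, ← List.cons_append, List.getLast?_concat]
      rw [exl] at hx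
      simp only [Option.mem_def, Option.some.injEq, List.nil_append, List.head?_cons] at hx hy
      subst hx; subst hy
      intro h1
      have : r' = linv a := eq_linv_of_ne ha (by simpa using h1)
      rw [this]
  · -- both tails non-empty with distinct first letters: short
    refine Junction.short z (a :: e) (b :: f) hc hc' ?_
    rw [isReduced_append_iff]
    refine ⟨hred₁, hred₂, ?_⟩
    intro x hx y hy
    have exl : (r :: invRev (a :: e)).getLast? = some (linv a) := by
      rw [invRev_cons_eq, ← List.cons_append, List.getLast?_concat]
    rw [exl] at hx
    simp only [Option.mem_def, Option.some.injEq, List.cons_append, List.head?_cons] at hx hy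
    subst hx; subst hy
    intro h1
    have hab : a ≠ b := hne a (by simp) b (by simp)
    have : b = linv a := eq_linv_of_ne hab (by simpa using h1)
    rw [this]

/-! #### The gluing step of the left-to-right reduction (short junctions keep the relator letters) -/

/-- **Gluing across a short junction**: if the reduced word of `u` ends `… r c⁻¹` and the next
letter is `t′ = c′ r′ c′⁻¹` with a SHORT junction, then the reduced word of `u t′` is obtained by
cancelling exactly the common prefix `z` — it again ends `… r′ c′⁻¹`. [folklore] -/
theorem glue {A c c' z c₁ c₂ : List Ltr} {r r' : Ltr} {u t' : F₂}
    (hu : u.toWord = A ++ r :: invRev c) (ht' : CNF c' r' t')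
    (hc : c = z ++ c₁) (hc' : c' = z ++ c₂) (hred : IsReduced ((r :: invRev c₁) ++ (c₂ ++ [r']))) :
    (u * t').toWord = (A ++ r :: invRev c₁ ++ c₂) ++ r' :: invRev c' := by
  have hu' : u = FreeGroup.mk (A ++ r :: invRev c₁) * (FreeGroup.mk z)⁻¹ := by
    rw [FreeGroup.inv_mk, FreeGroup.mul_mk, ← FreeGroup.mk_toWord (x := u), hu, hc,
      FreeGroup.invRev_append]
    simp [List.append_assoc]
  have ht'' : t' = FreeGroup.mk z * FreeGroup.mk (c₂ ++ r' :: invRev c') := by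
    rw [FreeGroup.mul_mk, ← List.append_assoc, ← hc', ← ht'.toWord_eq, FreeGroup.mk_toWord]
  have hprod : u * t' = FreeGroup.mk ((A ++ r :: invRev c₁) ++ (c₂ ++ r' :: invRev c')) := by
    rw [hu', ht'', show FreeGroup.mk ((A ++ r :: invRev c₁) ++ (c₂ ++ r' :: invRev c')) =
      FreeGroup.mk (A ++ r :: invRev c₁) * (FreeGroup.mk (c₂ ++ r' :: invRev c') : F₂) from
      FreeGroup.mul_mk.symm]
    group
  have h1 : IsReduced (A ++ r :: invRev c₁) := by
    have h := FreeGroup.isReduced_toWord (x := u)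
    rw [hu, hc, FreeGroup.invRev_append] at h
    exact h.infix ⟨[], invRev z, by simp⟩
  have h2 : IsReduced (c₂ ++ r' :: invRev c') := by
    have h := ht'.isReduced
    rw [hc'] at h
    exact h.infix ⟨z, [], by simp [hc', FreeGroup.invRev_append]⟩
  have h3 : IsReduced (A ++ (r :: invRev c₁) ++ (c₂ ++ [r'])) :=
    FreeGroup.IsReduced.append_overlap h1 hred (by simp)
  have h4 : IsReduced ((A ++ (r :: invRev c₁)) ++ (c₂ ++ [r']) ++ invRev c') :=
    FreeGroup.IsReduced.append_overlap h3 (by simpa [List.append_assoc] using h2) (by simp)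
  rw [hprod, FreeGroup.toWord_mk, FreeGroup.IsReduced.reduce_eq]
  · simp [List.append_assoc]
  · simpa [List.append_assoc] using h4

/-! #### Long junctions give descent moves -/

/-- `mk (L ++ a :: M) = mk L · mk [a] · mk M`. [folklore] -/
theorem mk_append_cons (L M : List Ltr) (a : Ltr) :
    (FreeGroup.mk (L ++ a :: M) : F₂) = FreeGroup.mk L * FreeGroup.mk [a] * FreeGroup.mk M := by
  rw [FreeGroup.mul_mk, FreeGroup.mul_mk, List.append_assoc, List.singleton_append]

/-- `long₁`: the forward Hurwitz move shortens the second letter by at least two. [folklore] -/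
theorem norm_long₁ {c c' : List Ltr} {r r' : Ltr} {t t' : F₂} (ht : CNF c r t) (ht' : CNF c' r' t')
    (f : List Ltr) (h : c' = c ++ linv r :: f) : (t * t' * t⁻¹).norm + 2 ≤ t'.norm := by
  have e1 : t * FreeGroup.mk c' = FreeGroup.mk (c ++ f) := by
    rw [ht.eq_mk, h, mk_append_cons, mk_linv, ← FreeGroup.mul_mk]
    group
  have e2 : t * t' * t⁻¹ =
      FreeGroup.mk (c ++ f) * FreeGroup.mk [r'] * (FreeGroup.mk (c ++ f))⁻¹ := by
    rw [← e1, ht'.eq_mk]; group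
  have b1 : (FreeGroup.mk (c ++ f) : F₂).norm ≤ c.length + f.length := by
    simpa using (FreeGroup.norm_mk_le (L₁ := c ++ f))
  have b2 : (FreeGroup.mk [r'] : F₂).norm ≤ 1 := by
    simpa using (FreeGroup.norm_mk_le (L₁ := [r']))
  have b3 := FreeGroup.norm_mul_le (FreeGroup.mk (c ++ f) * FreeGroup.mk [r'])
    ((FreeGroup.mk (c ++ f) : F₂)⁻¹)
  have b4 := FreeGroup.norm_mul_le (FreeGroup.mk (c ++ f) : F₂) (FreeGroup.mk [r'])
  rw [FreeGroup.norm_inv_eq] at b3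
  have hn' : t'.norm = 2 * c'.length + 1 := ht'.norm_eq
  rw [h] at hn'
  simp only [List.length_append, List.length_cons] at hn'
  rw [e2]
  omega

/-- `long₃`: the inverse Hurwitz move shortens the first letter by at least two. [folklore] -/
theorem norm_long₃ {c c' : List Ltr} {r r' : Ltr} {t t' : F₂} (ht : CNF c r t) (ht' : CNF c' r' t')
    (e : List Ltr) (h : c = c' ++ r' :: e) : (t'⁻¹ * t * t').norm + 2 ≤ t.norm := by
  have e1 : t'⁻¹ * FreeGroup.mk c = FreeGroup.mk (c' ++ e) := by
    rw [ht'.eq_mk, h, mk_append_cons, ← FreeGroup.mul_mk]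
    group
  have e2 : t'⁻¹ * t * t' =
      FreeGroup.mk (c' ++ e) * FreeGroup.mk [r] * (FreeGroup.mk (c' ++ e))⁻¹ := by
    have : t'⁻¹ * t * t' = (t'⁻¹ * FreeGroup.mk c) * FreeGroup.mk [r] * (t'⁻¹ * FreeGroup.mk c)⁻¹ := by
      rw [ht.eq_mk]; group
    rw [this, e1]
  have b1 : (FreeGroup.mk (c' ++ e) : F₂).norm ≤ c'.length + e.length := by
    simpa using (FreeGroup.norm_mk_le (L₁ := c' ++ e))
  have b2 : (FreeGroup.mk [r] : F₂).norm ≤ 1 := by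
    simpa using (FreeGroup.norm_mk_le (L₁ := [r]))
  have b3 := FreeGroup.norm_mul_le (FreeGroup.mk (c' ++ e) * FreeGroup.mk [r])
    ((FreeGroup.mk (c' ++ e) : F₂)⁻¹)
  have b4 := FreeGroup.norm_mul_le (FreeGroup.mk (c' ++ e) : F₂) (FreeGroup.mk [r])
  rw [FreeGroup.norm_inv_eq] at b3
  have hn : t.norm = 2 * c.length + 1 := ht.norm_eq
  rw [h] at hn
  simp only [List.length_append, List.length_cons] at hn
  rw [e2]
  omega

/-- `cancel`: the two letters are mutually inverse. [folklore] -/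
theorem eq_inv_of_cancel {c c' : List Ltr} {r r' : Ltr} {t t' : F₂} (ht : CNF c r t)
    (ht' : CNF c' r' t') (hc : c' = c) (hr : r' = linv r) : t' = t⁻¹ := by
  rw [ht'.eq_mk, ht.eq_mk, hc, hr, mk_linv]
  group

/-! #### Assembly -/

/-- `totalLen` of a four-letter state in terms of `FreeGroup.norm`. [folklore] -/
theorem totalLen_four (a b c d : F₂) :
    totalLen [a, b, c, d] = a.norm + b.norm + c.norm + d.norm := by
  simp [totalLen, FreeGroup.norm, add_assoc]

/-- **THE DESCENT LEMMA HOLDS** (`Descent`, machine-checked): for every reachable state, either a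
linearly adjacent pair cancels or a single move strictly lowers the total reduced length.  Proof:
conjugate normal forms of the four letters; the junction trichotomy at `(1,2)`, `(2,3)`, `(3,4)`;
a LONG junction gives the move (or the cancelling pair); three SHORT junctions are impossible
because gluing keeps all four relator letters in the reduced word of the product, which is `1`.
[folklore] -/
theorem descent_holds : Descent := by
  intro w P Q s hP hQ hr
  have hprod : s.prod = 1 := prod_eq_one_of_reachable hP hQ hr
  have hlen : s.length = 4 := by rw [← reachable_length_eq hr]; rfl
  have hsgn : AllSigned s := reachable_allSigned hr (startState_allSigned hP hQ)
  rcases s with _ | ⟨t₁, _ | ⟨t₂, _ | ⟨t₃, _ | ⟨t₄, _ | ⟨t₅, s⟩⟩⟩⟩⟩ <;> simp at hlen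
  obtain ⟨c₁, r₁, h₁⟩ := exists_cnf_of_signed (hsgn t₁ (by simp))
  obtain ⟨c₂, r₂, h₂⟩ := exists_cnf_of_signed (hsgn t₂ (by simp))
  obtain ⟨c₃, r₃, h₃⟩ := exists_cnf_of_signed (hsgn t₃ (by simp))
  obtain ⟨c₄, r₄, h₄⟩ := exists_cnf_of_signed (hsgn t₄ (by simp))
  have hprod' : t₁ * t₂ * t₃ * t₄ = 1 := by simpa [mul_assoc] using hprod
  -- junction (1,2)
  rcases junction h₁ h₂ with ⟨f, hf⟩ | ⟨hc, hrr⟩ | ⟨e, he⟩ | ⟨z₁, d₁, d₂, hd₁, hd₂, hb₁⟩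
  · right
    refine ⟨[t₁ * t₂ * t₁⁻¹, t₁, t₃, t₄], Or.inl (Move.hurwitz [] [t₃, t₄] t₁ t₂), ?_⟩
    have := norm_long₁ h₁ h₂ f hf
    rw [totalLen_four, totalLen_four]; omega
  · left
    exact ⟨[], [t₃, t₄], t₁, by rw [eq_inv_of_cancel h₁ h₂ hc hrr]; rfl⟩
  · right
    refine ⟨[t₂, t₂⁻¹ * t₁ * t₂, t₃, t₄], Or.inl (Move.hurwitzInv [] [t₃, t₄] t₁ t₂), ?_⟩
    have := norm_long₃ h₁ h₂ e he
    rw [totalLen_four, totalLen_four]; omega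
  -- junction (2,3)
  rcases junction h₂ h₃ with ⟨f, hf⟩ | ⟨hc, hrr⟩ | ⟨e, he⟩ | ⟨z₂, d₃, d₄, hd₃, hd₄, hb₂⟩
  · right
    refine ⟨[t₁, t₂ * t₃ * t₂⁻¹, t₂, t₄], Or.inl (Move.hurwitz [t₁] [t₄] t₂ t₃), ?_⟩
    have := norm_long₁ h₂ h₃ f hf
    rw [totalLen_four, totalLen_four]; omega
  · left
    exact ⟨[t₁], [t₄], t₂, by rw [eq_inv_of_cancel h₂ h₃ hc hrr]; rfl⟩
  · right
    refine ⟨[t₁, t₃, t₃⁻¹ * t₂ * t₃, t₄], Or.inl (Move.hurwitzInv [t₁] [t₄] t₂ t₃), ?_⟩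
    have := norm_long₃ h₂ h₃ e he
    rw [totalLen_four, totalLen_four]; omega
  -- junction (3,4)
  rcases junction h₃ h₄ with ⟨f, hf⟩ | ⟨hc, hrr⟩ | ⟨e, he⟩ | ⟨z₃, d₅, d₆, hd₅, hd₆, hb₃⟩
  · right
    refine ⟨[t₁, t₂, t₃ * t₄ * t₃⁻¹, t₃], Or.inl (Move.hurwitz [t₁, t₂] [] t₃ t₄), ?_⟩
    have := norm_long₁ h₃ h₄ f hf
    rw [totalLen_four, totalLen_four]; omega
  · left
    exact ⟨[t₁, t₂], [], t₃, by rw [eq_inv_of_cancel h₃ h₄ hc hrr]; rfl⟩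
  · right
    refine ⟨[t₁, t₂, t₄, t₄⁻¹ * t₃ * t₄], Or.inl (Move.hurwitzInv [t₁, t₂] [] t₃ t₄), ?_⟩
    have := norm_long₃ h₃ h₄ e he
    rw [totalLen_four, totalLen_four]; omega
  -- all three junctions short: the product cannot be `1`
  exfalso
  have e12 := glue h₁.toWord_eq h₂ hd₁ hd₂ hb₁
  have e123 := glue e12 h₃ hd₃ hd₄ hb₂
  have e1234 := glue e123 h₄ hd₅ hd₆ hb₃
  rw [hprod', FreeGroup.toWord_one] at e1234
  simp at e1234


end DescentProof

/-! ### §L-K THE LEVER, PROVED -/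

/-- **K4-WALK (double target) holds for ALL `(w, P, Q)`** — `Descent` (`descent_holds`) and
`Terminal` (`terminal_holds`) feed the strong induction `lever_of_descent_of_terminal`.
[folklore] -/
theorem lever_holds (w : F₂) (P Q : F₂ × F₂) (hP : P ∈ XYPairs w) (hQ : Q ∈ XYPairs w) :
    ∃ t : List F₂, Reachable (startState P Q) t ∧ IsDoubleState t :=
  lever_of_descent descent_holds w P Q hP hQ

/-- **`stub_shadowWalkK4` HOLDS** — verbatim the registered signature of the picked line's lever
(`Cruxes/PlanarAcyclicBisectionRigidity/Lines/Sketch.lean`, Stub 2), sorry-free.  Provers: land a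
copy under `Theorems/` (this work file may not be imported by a closing proof). [folklore] -/
theorem stub_shadowWalkK4_holds (w : F₂) (P Q : F₂ × F₂)
    (hP : P ∈ XYPairs w) (hQ : Q ∈ XYPairs w) :
    ∃ t : List F₂, Literature.Topology.FourManifolds.PlanarShadow.Reachable (startState P Q) t ∧
      (IsBallState t ∨ IsDoubleState t) :=
  stub_shadowWalkK4_of_descent descent_holds w P Q hP hQ

end Line

end Summit.SmoothPoincare4.SmoothPoincare4.Cruxes.PlanarAcyclicBisectionRigidity.Disproof
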